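import Summits.Ventures.CertifiedArithmetic.LowPrec.SRAccumulationOptimal
import Summits.Ventures.CertifiedArithmetic.LowPrec.SROptimalBudget
import HarnessLib

/-!
# Stochastic rounding in low-precision formats LXVI (ledger) — the class of conditionally unbiased
# schemes is non-trivial and SR attains the optimum: unbiasedness of admissible schemes, the SR
# scheme, kernel decision of admissibility, and the FP4 ledger of `LowPrec/SRAccumulationOptimal`

HONEST FRAMING: certified error envelopes and provably optimal rounding/accumulation schemes for
low-precision formats under stated cost models; every table by two implementations; no hardware or
vendor claims.

Companion of `LowPrec/SRAccumulationOptimal` (`accExp_le_exp`: inside a corridor, recursive SR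
minimises `E f(ŝₙ)` for every convex `f` over all admissible = adapted, arbitrarily randomised,
conditionally unbiased `F`-valued schemes `T`).
1. `Adm.exp_id`: every admissible scheme is exactly unbiased, `E_T ŝₙ = s + ∑ xₖ` — the class is
   precisely "unbiased at every step".
2. `srScheme` (node law = `srLaw` of `LowPrec/SROptimalBudget`), `srScheme_exp`, `srScheme_adm`,
   `exists_adm_exp_eq_accExp`: recursive SR is itself an admissible scheme (inside any corridor) and its value is `accExp`, so the bound of the
   main theorem is attained: `accExp F x n f s = min_T E_T f(ŝₙ)`.
3. `admB`, `instDecidableAdm`: admissibility of a concrete finite scheme is kernel-decidable.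
4. FP4 LEDGER (`FP4.optimal_accumulation_witness`, kernel-checked on the literal E2M1 table):
   `s = 1`, `x = (1/4, 1)`, exact sum `9/4`, corridor `a ≡ 0`, `b = (2, 3, 4)`.  SR: MSE
   `accVar = 3/16`.  The unbiased "dither" scheme (first state `1/2` or `2` w.p. `1/2`, then exact)
   is admissible with MSE `9/16`; the unbiased off-cell scheme (first state `1` w.p. `3/4`, `2`
   w.p. `1/4`, then exact) is admissible and TIES at `3/16` — the minimiser is not unique for
   `n = 2` (`FP4.optimal_accumulation_fp4`: every admissible competitor on this corridor has MSE
   `≥ 3/16`, an instance of `accVar_le_exp_sq`).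
-/

namespace Summit.Ventures.CertifiedArithmetic.LowPrec.SR

open Literature.ComputerArithmetic.ConnollyHighamMary2021
open Finset

variable {K : Type*} [Field K] [LinearOrder K] [IsStrictOrderedRing K]

/-! ### Admissible schemes are unbiased; SR is admissible and attains the bound -/

omit [IsStrictOrderedRing K] in
/-- Every admissible scheme is (exactly) unbiased: `E_T ŝₙ = s + ∑ xₖ`. -/
theorem Adm.exp_id {F : Finset K} :
    ∀ (n : ℕ) (a b x : ℕ → K) (s : K) (T : Scheme K), Adm F a b x n s T →
      T.exp F (fun t => t) s = s + ∑ i ∈ range n, x i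
  | 0, _, _, _, _, .leaf, _ => by simp [Scheme.exp]
  | 0, _, _, _, _, .node _ _, hA => False.elim hA
  | _ + 1, _, _, _, _, .leaf, hA => False.elim hA
  | n + 1, a, b, x, s, .node w ch, hA => by
      obtain ⟨-, h1, hmean, -, hch⟩ := hA
      rw [Scheme.exp, sum_range_succ' x n]
      have key : ∀ y ∈ F, w y * (ch y).exp F (fun t => t) y
          = w y * y + (∑ i ∈ range n, x (i + 1)) * w y := by
        intro y hy
        by_cases hy0 : w y = 0
        · simp [hy0]
        · rw [Adm.exp_id n _ _ _ y (ch y) (hch y hy hy0)]; ring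
      rw [sum_congr rfl key, sum_add_distrib, ← mul_sum, hmean, h1]
      ring

/-- Recursive SR as a `Scheme`: the node law is the two-point SR law `srLaw F (s + x₀)` of
`LowPrec/SROptimalBudget` (mass `1 − p↑` on `⌊c̄⌋`, `p↑` on `⌈c̄⌉`), the same whatever the history
(SR is memoryless). -/
def srScheme (F : Finset K) : (ℕ → K) → ℕ → K → Scheme K
  | _, 0, _ => .leaf
  | x, n + 1, s => .node (srLaw F (s + x 0)) (fun y => srScheme F (fun i => x (i + 1)) n y)

omit [IsStrictOrderedRing K] in
/-- The support of the SR law is `{⌊c̄⌋, ⌈c̄⌉}`. -/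
theorem eq_up_or_dn_of_srLaw_ne_zero {F : Finset K} {c y : K} (h : srLaw F c y ≠ 0) :
    y = up F c ∨ y = dn F c := by
  by_contra hne
  push Not at hne
  apply h
  simp [srLaw, hne.1, hne.2]

omit [IsStrictOrderedRing K] in
/-- The SR scheme computes `accExp`: `E_{srScheme} f(ŝₙ) = accExp F x n f s`. -/
theorem srScheme_exp {F : Finset K} (hF : F.Nonempty) (f : K → K) :
    ∀ (n : ℕ) (x : ℕ → K) (s : K), (srScheme F x n s).exp F f s = accExp F x n f s
  | 0, _, _ => rfl
  | n + 1, x, s => by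
      have ih : ∀ y, (srScheme F (fun i => x (i + 1)) n y).exp F f y
          = accExp F (fun i => x (i + 1)) n f y := fun y => srScheme_exp hF f n _ y
      simp only [srScheme, Scheme.exp, accExp, ih]
      exact sum_srLaw_mul hF _ _

/-- Inside a corridor the SR scheme is admissible (unbiased: `step_id`; supported on the two
candidates, which lie in the next window). -/
theorem srScheme_adm {F : Finset K} :
    ∀ (n : ℕ) (a b x : ℕ → K) (s : K), Corridor F a b x n → a 0 ≤ s → s ≤ b 0 →
      Adm F a b x n s (srScheme F x n s)
  | 0, _, _, _, _, _, _, _ => trivial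
  | n + 1, a, b, x, s, hC, hs1, hs2 => by
      have hF : F.Nonempty := ⟨a 0, hC.lo_mem 0 (by omega)⟩
      have hm1 : a 1 ≤ s + x 0 := (hC.lo_step 0 (by omega)).trans (by linarith)
      have hm2 : s + x 0 ≤ b 1 := le_trans (by linarith) (hC.hi_step 0 (by omega))
      have ha1 := hC.lo_mem 1 (by omega)
      have hb1 := hC.hi_mem 1 (by omega)
      have hc : InHull F (s + x 0) := ⟨⟨a 1, ha1, hm1⟩, ⟨b 1, hb1, hm2⟩⟩
      have hwin : ∀ y, srLaw F (s + x 0) y ≠ 0 → a 1 ≤ y ∧ y ≤ b 1 := by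
        intro y hy
        rcases eq_up_or_dn_of_srLaw_ne_zero hy with h | h <;> subst h
        · exact ⟨hm1.trans (le_up_of_inHull hc), up_le_of_mem hb1 hm2⟩
        · exact ⟨le_dn_of_mem ha1 hm1, (dn_le_of_inHull hc).trans hm2⟩
      simp only [srScheme, Adm]
      refine ⟨fun y _ => srLaw_nonneg F _ y, ?_, ?_, fun y _ hy => hwin y hy, fun y _ hy => ?_⟩
      · simpa [step_const] using sum_srLaw_mul hF (s + x 0) (fun _ => (1 : K))
      · rw [sum_srLaw_mul hF, step_id, clamp_eq_self hc]
      · obtain ⟨hy1, hy2⟩ := hwin y hy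
        exact srScheme_adm n _ _ _ y hC.succ hy1 hy2

/-- **SR attains the bound**: the infimum of `E_T f(ŝₙ)` over admissible `T` is the SR value. -/
theorem exists_adm_exp_eq_accExp {F : Finset K} {n : ℕ} {a b x : ℕ → K} {s : K}
    (hC : Corridor F a b x n) (hs1 : a 0 ≤ s) (hs2 : s ≤ b 0) (f : K → K) :
    ∃ T : Scheme K, Adm F a b x n s T ∧ T.exp F f s = accExp F x n f s :=
  ⟨srScheme F x n s, srScheme_adm n a b x s hC hs1 hs2,
    srScheme_exp ⟨a 0, hC.lo_mem 0 (Nat.zero_le _)⟩ f n x s⟩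

/-! ### Kernel decision of admissibility, and the FP4 ledger -/

/-- Boolean evaluator of `Adm` (clean kernel reduction for `decide` certificates). -/
def admB (F : Finset K) : (ℕ → K) → (ℕ → K) → (ℕ → K) → ℕ → K → Scheme K → Bool
  | _, _, _, 0, _, .leaf => true
  | _, _, _, 0, _, .node _ _ => false
  | _, _, _, _ + 1, _, .leaf => false
  | a, b, x, n + 1, s, .node w ch =>
      decide (∀ y ∈ F, 0 ≤ w y) && decide ((∑ y ∈ F, w y) = 1) &&
      decide ((∑ y ∈ F, w y * y) = s + x 0) && decide (∀ y ∈ F, w y ≠ 0 → a 1 ≤ y ∧ y ≤ b 1) &&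
      decide (∀ y ∈ F, w y ≠ 0 →
        admB F (fun i => a (i + 1)) (fun i => b (i + 1)) (fun i => x (i + 1)) n y (ch y) = true)

omit [IsStrictOrderedRing K] in
/-- `admB` computes `Adm`. -/
theorem admB_iff (F : Finset K) : ∀ (n : ℕ) (a b x : ℕ → K) (s : K) (T : Scheme K),
    admB F a b x n s T = true ↔ Adm F a b x n s T
  | 0, _, _, _, _, .leaf => by simp [admB, Adm]
  | 0, _, _, _, _, .node _ _ => by simp [admB, Adm]
  | _ + 1, _, _, _, _, .leaf => by simp [admB, Adm]
  | n + 1, a, b, x, s, .node w ch => by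
      have ih : ∀ y, admB F (fun i => a (i + 1)) (fun i => b (i + 1)) (fun i => x (i + 1)) n y
          (ch y) = true ↔ Adm F (fun i => a (i + 1)) (fun i => b (i + 1)) (fun i => x (i + 1)) n y
          (ch y) := fun y => admB_iff F n _ _ _ y (ch y)
      simp only [admB, Adm, Bool.and_eq_true, decide_eq_true_eq, ih, and_assoc]

/-- `Adm` is decidable (via `admB`). -/
instance instDecidableAdm (F : Finset K) (a b x : ℕ → K) (n : ℕ) (s : K) (T : Scheme K) :
    Decidable (Adm F a b x n s T) :=
  decidable_of_iff _ (admB_iff F n a b x s T)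

namespace FP4

/-- Summands of the FP4 ledger: `x = (1/4, 1)`. -/
def xs2 (i : ℕ) : ℚ := if i = 0 then 1 / 4 else 1

/-- Upper corridor `b = (2, 3, 4)` (lower corridor `a ≡ 0`). -/
def hi3 (i : ℕ) : ℚ := if i = 0 then 2 else if i = 1 then 3 else 4

/-- The unbiased "dither" competitor: first state `1/2` or `2` w.p. `1/2` each (mean `5/4 = 1 + 1/4`),
then the exact (deterministic, unbiased) second step `y ↦ y + 1 ∈ F`. -/
def ditherScheme : Scheme ℚ :=
  .node (fun y => if y = 1 / 2 ∨ y = 2 then 1 / 2 else 0)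
    (fun y => .node (fun z => if z = y + 1 then 1 else 0) (fun _ => .leaf))

/-- The unbiased off-cell competitor: first state `1` w.p. `3/4` or `2` w.p. `1/4` (mean `5/4`), then
exact. -/
def skipScheme : Scheme ℚ :=
  .node (fun y => if y = 1 then 3 / 4 else if y = 2 then 1 / 4 else 0)
    (fun y => .node (fun z => if z = y + 1 then 1 else 0) (fun _ => .leaf))

/-- **FP4 ledger (kernel-checked on the literal E2M1 table).**  `s = 1`, `x = (1/4, 1)`, `s₂ = 9/4`:
the corridor `a ≡ 0`, `b = (2,3,4)` is valid; SR has MSE `accVar = 3/16`; the dither competitor is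
admissible with MSE `9/16 (> 3/16)`; the off-cell competitor is admissible and ties at `3/16` — the
minimiser is not unique for `n = 2`. -/
theorem optimal_accumulation_witness :
    Corridor e2m1 (fun _ => 0) hi3 xs2 2 ∧
    accVar e2m1 xs2 2 1 = 3 / 16 ∧
    Adm e2m1 (fun _ => 0) hi3 xs2 2 1 ditherScheme ∧
    ditherScheme.exp e2m1 (fun t => (t - 9 / 4) ^ 2) 1 = 9 / 16 ∧
    Adm e2m1 (fun _ => 0) hi3 xs2 2 1 skipScheme ∧
    skipScheme.exp e2m1 (fun t => (t - 9 / 4) ^ 2) 1 = 3 / 16 := by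
  refine ⟨⟨by decide +kernel, by decide +kernel, by decide +kernel, by decide +kernel⟩,
    by decide +kernel, by decide +kernel, by decide +kernel, by decide +kernel, by decide +kernel⟩

/-- The ledger instance of the main theorem: every admissible competitor on this corridor has
MSE `≥ 3/16`. -/
theorem optimal_accumulation_fp4 (T : Scheme ℚ) (hA : Adm e2m1 (fun _ => 0) hi3 xs2 2 1 T) :
    3 / 16 ≤ T.exp e2m1 (fun t => (t - 9 / 4) ^ 2) 1 := by
  have h := accVar_le_exp_sq optimal_accumulation_witness.1 (by norm_num) (by decide +kernel) hA
  have e : (1 : ℚ) + ∑ i ∈ range 2, xs2 i = 9 / 4 := by decide +kernel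
  rw [e, optimal_accumulation_witness.2.1] at h
  exact h

end FP4

end Summit.Ventures.CertifiedArithmetic.LowPrec.SR
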